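import Summits.QuantumFields.YangMills.Theorems.FlatTubeReductionRecordRateBricks
import Summits.QuantumFields.YangMills.Theorems.LuscherReductionTwistedTraceScalingRecordAnalytic
import HarnessLib

/-!
# THE HAND-OFF OBJECT of the rate twin: `RecordAnalyticRateInput L s M` → K1 `NearFlatRatioLaw` (and FCL 23943) — rate twin of lane A's `…RecordAnalytic` (p652422)
# (route `FlatTubeReduction`, crux K1 `NearFlatRatioLaw` stmt-QuantumFields-24720; seat `ym-line-ftr-p1` g9; R2b1 RECORD rung — no summit statement is proved here)

`RecordAnalyticRateInput L s M` (orbit factor `K = 43`, window radius `recordDelta1 L s = 14β^{-s}/|Site|`, as lane A) = ONLY the analytic data of the rate twin: the ADAPTED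
equivariant fibre profile `Ω β u v` (+ support radius `r`, `12|Site|·r < β^{-s}` eventually), the DRESSED weight `W β u` (+ its vacuum behaviour), `σ, γ > 0`, rates `κ, b`
(`= O(λ_b²)`), `θ₀`, and the FOUR analytic bricks (B-N) (window), (B-T)-RATE (dressed), (B-ST), (B-OD).  Everything structural comes from the tree: lane A's
`record_structural_inequalities` (p652155: `hδ₁`, `hradii`, (S1) `hshadow` via `recordChi_shadow`), and ★ `sqrt_bareLambda_le_recordDelta1` (`√λ_b(L³β) ≤ δ₁` eventually for
`s < 1/6` — the quasimode's support sits in the window).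
* ★ `sqrt_bareLambda_le_recordDelta1`; `softTubeAdmissible_recordChi'` (any `K ≥ 1`, `M ≥ 2`);
* `RecordAnalyticRateInput.toRecordBORateInput` (all of `RecordBORateInput`'s structural fields);
* ★★★★ `nearFlatRatioLaw_of_analyticRateInput (M ≥ 2) : (∀ L ≥ 2, RecordAnalyticRateInput L (1/40) M) → NearFlatRatioLaw`, and `femtoGapFixedLattice_of_analyticRateInput`.
HONEST FRAMING: the analytic bricks at rate grade (and the construction of Ω, W) are OPEN fixed-lattice semiclassics (pooled with RED lane A's C4-CORE, crux 20203); this file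
is bookkeeping; femto rung R2b1 (RECORD label); not infinite volume, not a gap, not Clay.  One `structure`, one instance `def`, no `sorry`.
-/

set_option autoImplicit false

noncomputable section

open MeasureTheory Filter Topology Real
open scoped BigOperators
open Literature.MathematicalPhysics.QuantumFieldTheory
open Literature.MathematicalPhysics.QuantumLattice

namespace Summit.QuantumFields.YangMills.Theorems.FemtoTransferGap.RateTube

open Summit.QuantumFields.YangMills.Theorems.FemtoTransferGap
open Summit.QuantumFields.YangMills.Theorems.FemtoTransferGap.TwoLattice.Avg
open Summit.QuantumFields.YangMills.Theorems.FemtoTransferGap.TwoLattice.ConstTube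
open Summit.QuantumFields.YangMills.Theorems.FemtoTransferGap.TwoLattice.Stiff (LinkSpace)
open Summit.QuantumFields.YangMills.Theorems.FemtoCutoffLadder

variable {L : ℕ} [NeZero L]

/-! ## §1 Two eventual inequalities -/

/-- ★ `√λ_b(L³β) ≤ recordDelta1 L s β = 14β^{-s}/|Site|` eventually, for `0 < s < 1/6` (`√λ_b(B) = (2/B)^{1/6} ≤ 2^{1/6}β^{-1/6}`). [folklore] -/
theorem sqrt_bareLambda_le_recordDelta1 {s : ℝ} (hs : 0 < s) (hs6 : s < 1 / 6) :
    ∀ᶠ β : ℝ in atTop, Real.sqrt (bareLambda ((L : ℝ) ^ 3 * β)) ≤ recordDelta1 L s β := by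
  have hN := card_site_pos (L := L)
  have hL3 : (1 : ℝ) ≤ (L : ℝ) ^ 3 := one_le_pow₀ (by exact_mod_cast NeZero.one_le)
  -- `β^{-(1/6 - s)} → 0`
  have ht : Tendsto (fun β : ℝ => β ^ (-(1 / 6 - s))) atTop (𝓝 0) := tendsto_rpow_neg_atTop (by linarith)
  set c : ℝ := 14 / (2 * Fintype.card (Site 3 L)) with hc
  have hc0 : 0 < c := by rw [hc]; positivity
  filter_upwards [ht.eventually (gt_mem_nhds hc0), Filter.eventually_ge_atTop (1 : ℝ)] with β hβ hβ1
  have hβ0 : 0 < β := by linarith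
  have hB0 : 0 < (L : ℝ) ^ 3 * β := by positivity
  -- `√λ(B) ≤ √λ(β) = (2/β)^{1/6} ≤ 2 β^{-1/6}`
  have h1 : bareLambda ((L : ℝ) ^ 3 * β) ≤ bareLambda β := by
    unfold bareLambda
    exact Real.rpow_le_rpow (by positivity) (div_le_div_of_nonneg_left (by norm_num) hβ0 (by nlinarith)) (by norm_num)
  have h2 : Real.sqrt (bareLambda β) = (2 / β) ^ ((1 : ℝ) / 6) := by
    unfold bareLambda
    rw [Real.sqrt_eq_rpow, ← Real.rpow_mul (by positivity)]; norm_num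
  have h3 : (2 / β) ^ ((1 : ℝ) / 6) ≤ 2 * β ^ (-((1 : ℝ) / 6)) := by
    rw [Real.div_rpow (by norm_num) hβ0.le, Real.rpow_neg hβ0.le, div_eq_mul_inv]
    refine mul_le_mul_of_nonneg_right ?_ (by positivity)
    calc (2 : ℝ) ^ ((1 : ℝ) / 6) ≤ (2 : ℝ) ^ (1 : ℝ) := Real.rpow_le_rpow_of_exponent_le (by norm_num) (by norm_num)
      _ = 2 := Real.rpow_one 2
  -- `2 β^{-1/6} = 2 β^{-(1/6-s)} β^{-s} < 14 β^{-s}/|Site|`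
  have h4 : β ^ (-((1 : ℝ) / 6)) = β ^ (-(1 / 6 - s)) * β ^ (-s) := by rw [← Real.rpow_add hβ0]; ring_nf
  have hβs : 0 < β ^ (-s) := Real.rpow_pos_of_pos hβ0 _
  have h5 : 2 * (β ^ (-(1 / 6 - s)) * β ^ (-s)) ≤ 14 * β ^ (-s) / Fintype.card (Site 3 L) := by
    rw [le_div_iff₀ hN]
    have := mul_le_mul_of_nonneg_right hβ.le hβs.le
    rw [hc] at this
    have e : 14 / (2 * (Fintype.card (Site 3 L) : ℝ)) * β ^ (-s) * (2 * Fintype.card (Site 3 L)) = 14 * β ^ (-s) := by field_simp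
    nlinarith [this, e]
  unfold recordDelta1
  rw [powScale_eq hβ1]
  calc Real.sqrt (bareLambda ((L : ℝ) ^ 3 * β)) ≤ Real.sqrt (bareLambda β) := Real.sqrt_le_sqrt h1
    _ = (2 / β) ^ ((1 : ℝ) / 6) := h2
    _ ≤ 2 * β ^ (-((1 : ℝ) / 6)) := h3
    _ = 2 * (β ^ (-(1 / 6 - s)) * β ^ (-s)) := by rw [h4]
    _ ≤ 14 * β ^ (-s) / Fintype.card (Site 3 L) := h5

/-- The record weight `recordChi L s K M` (`K ≥ 1`, `M ≥ 2`) is admissible at the inner radius `β^{-s}`. [folklore] -/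
theorem softTubeAdmissible_recordChi' (s K M : ℝ) (hK : 1 ≤ K) (hM : 2 ≤ M) : SoftTubeAdmissible L (powScale s) (recordChi L s K M) := by
  refine softTubeAdmissible_mono (δ' := fun β => K * powScale s β) (fun β => by nlinarith [powScale_pos s β]) ?_
  show SoftTubeAdmissible L (fun β => K * powScale s β) (recordWeightRho L (fun β => K * powScale s β) (fun b => M * (K * powScale s b)) (powScale 1))
  exact softTubeAdmissible_recordWeightRho L (fun β => by nlinarith [powScale_pos s β]) (fun β => by
    have h0 : 0 ≤ K * powScale s β := by nlinarith [powScale_pos s β]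
    show 2 * (K * powScale s β) ≤ M * (K * powScale s β)
    nlinarith [h0])

/-! ## §2 The analytic input (rate grade) -/

variable (L) in
/-- **THE ANALYTIC INPUT OF THE RATE TWIN** at fat factor `M` (`K = 43`, window `recordDelta1 L s`): adapted profile, dressed weight, constants, and the four analytic bricks.
[cite: Luscher1983, §3] [cite: SjostrandZworski2007, §2] -/
structure RecordAnalyticRateInput (s M : ℝ) where
  /-- adapted fibre profile, dressed weight, profile radius, constants -/
  Ω : ℝ → GaugeConfig 3 1 SU2 → LinkSpace L → ℝ
  W : ℝ → GaugeConfig 3 1 SU2 → ℝ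
  r : ℝ → ℝ
  σ : ℝ → ℝ
  γ : ℝ → ℝ
  κ : ℝ → ℝ
  b : ℝ → ℝ
  θ₀ : ℝ
  κW : ℝ
  hΩm : ∀ β, Measurable (Function.uncurry (Ω β))
  hΩ1 : ∀ β u x, |Ω β u x| ≤ 1
  hΩinv : ∀ β (g : SU2) (u : GaugeConfig 3 1 SU2) (v : LinkSpace L), Ω β (gaugeTransform (fun _ : Site 3 1 => g) u) (adL L g v) = Ω β u v
  hΩr : ∀ β u x, Ω β u x ≠ 0 → ‖x‖ ≤ r β
  hr : ∀ β, 0 ≤ r β ∧ r β ≤ 1 / 2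
  hr_small : ∀ᶠ β in atTop, 12 * Fintype.card (Site 3 L) * r β < powScale s β
  hWm : ∀ β, Measurable (W β)
  hW0 : ∀ β u, 0 ≤ W β u
  hW1 : ∀ β u, W β u ≤ 1
  hWinv : ∀ β (g : Site 3 1 → SU2) (u : GaugeConfig 3 1 SU2), W β (gaugeTransform g u) = W β u
  hκW : 0 ≤ κW
  hWvac : ∀ᶠ β in atTop, ∀ u : GaugeConfig 3 1 SU2, (∀ e : Edge 3 1, 0 < scalarPart (u e)) → orbitDist u < Real.sqrt (bareLambda ((L : ℝ) ^ 3 * β)) →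
    0 < W β u ∧ W β u ≤ 1 ∧ 1 ≤ W β u ^ 2 * (1 + κW * ‖zmCoord 1 u‖ ^ 2)
  hγ : ∀ β, 0 < γ β
  hσ : ∀ β, 0 < σ β
  hκ0 : ∀ β, 0 ≤ κ β
  hκ_small : ∃ a : ℝ, ∀ᶠ β in atTop, κ β ≤ a * bareLambda ((L : ℝ) ^ 3 * β) ^ 2
  hb : ∀ β, 0 ≤ b β
  hb_small : ∃ a : ℝ, ∀ᶠ β in atTop, b β ^ 2 ≤ a * bareLambda ((L : ℝ) ^ 3 * β) ^ 2
  hθ₀ : 0 < θ₀ ∧ θ₀ ≤ 1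
  /-- (B-N) on the window -/
  hN : ∀ᶠ β in atTop, ∀ u : GaugeConfig 3 1 SU2, orbitDist u < recordDelta1 L s β →
    |fibreMassAd L (softWeight (recordChi L s 43 M β)) (Ω β) u - γ β| ≤ κ β * γ β
  /-- (B-T)-RATE against the dressed one-site form -/
  hT : ∀ᶠ β in atTop, ∀ φ : GaugeConfig 3 1 SU2 → ℝ, Measurable φ → (∃ C : ℝ, ∀ u, |φ u| ≤ C) →
    (∀ (g : Site 3 1 → SU2) (u : GaugeConfig 3 1 SU2), φ (gaugeTransform g u) = φ u) → (∀ u, φ u ≠ 0 → orbitDist u < recordDelta1 L s β) →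
    |tubeForm β (boFunAd L φ (Ω β)) - σ β * γ β * qform su2Rep ((L : ℝ) ^ 3 * β) (fun u => φ u * W β u) (fun u => φ u * W β u)| ≤
      κ β * (σ β * γ β) * (qform su2Rep ((L : ℝ) ^ 3 * β) (fun u => φ u * W β u) (fun u => φ u * W β u) + levelValue su2Rep 1 ((L : ℝ) ^ 3 * β) 0 * l2 φ φ)
  /-- (B-ST) -/
  hST : ∀ᶠ β in atTop, ∀ v : GaugeConfig 3 L SU2 → ℝ, Measurable v → (∃ C : ℝ, ∀ U, |v U| ≤ C) → (∀ U, v U ≠ 0 → recordChi L s 43 M β U ≠ 0) →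
    (∀ u, fibreInnerAd L (softWeight (recordChi L s 43 M β)) (Ω β) v u = 0) →
    tubeForm β v ≤ (1 - θ₀) * (σ β * levelValue su2Rep 1 ((L : ℝ) ^ 3 * β) 0) * tubeNormSq (softWeight (recordChi L s 43 M β)) v
  /-- (B-OD), `b² = O(λ_b²)` -/
  hOD : ∀ᶠ β in atTop, ∀ (φ : GaugeConfig 3 1 SU2 → ℝ) (v : GaugeConfig 3 L SU2 → ℝ), Measurable φ → (∃ C : ℝ, ∀ u, |φ u| ≤ C) →
    (∀ u, φ u ≠ 0 → orbitDist u < recordDelta1 L s β) → Measurable v → (∃ C : ℝ, ∀ U, |v U| ≤ C) → (∀ U, v U ≠ 0 → recordChi L s 43 M β U ≠ 0) →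
    (∀ u, fibreInnerAd L (softWeight (recordChi L s 43 M β)) (Ω β) v u = 0) →
    |tubeCross β (boFunAd L φ (Ω β)) v| ≤ b β * (σ β * levelValue su2Rep 1 ((L : ℝ) ^ 3 * β) 0) *
        Real.sqrt (tubeNormSq (softWeight (recordChi L s 43 M β)) (boFunAd L φ (Ω β))) * Real.sqrt (tubeNormSq (softWeight (recordChi L s 43 M β)) v) ∧
    |tubeCross β v (boFunAd L φ (Ω β))| ≤ b β * (σ β * levelValue su2Rep 1 ((L : ℝ) ^ 3 * β) 0) *
        Real.sqrt (tubeNormSq (softWeight (recordChi L s 43 M β)) (boFunAd L φ (Ω β))) * Real.sqrt (tubeNormSq (softWeight (recordChi L s 43 M β)) v)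

/-- The analytic rate input extends to the full rate input (all structural fields from the tree; `0 < s < 1/6`). [folklore] -/
def RecordAnalyticRateInput.toRecordBORateInput {s M : ℝ} (hs : 0 < s) (hs6 : s < 1 / 6) (hM : 0 ≤ M) (A : RecordAnalyticRateInput L s M) :
    RecordBORateInput L s 43 M :=
  have hSI := record_structural_inequalities (L := L) hs (by linarith) A.hr_small
  { Ω := A.Ω, W := A.W, r := A.r, δ₁ := recordDelta1 L s, σ := A.σ, γ := A.γ, κ := A.κ, b := A.b, θ₀ := A.θ₀, κW := A.κW,
    hΩm := A.hΩm, hΩ1 := A.hΩ1, hΩinv := A.hΩinv, hΩr := A.hΩr, hWm := A.hWm, hW0 := A.hW0, hW1 := A.hW1, hWinv := A.hWinv, hκW := A.hκW,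
    hWvac := A.hWvac, hr := A.hr, hγ := A.hγ, hδ₁ := hSI.1, hcoreR := sqrt_bareLambda_le_recordDelta1 hs hs6, hradii := hSI.2.2.1,
    hshadow := hSI.2.2.2 43 M (by norm_num) hM,
    hσ := A.hσ, hκ0 := A.hκ0, hκ_small := A.hκ_small, hb := A.hb, hb_small := A.hb_small, hθ₀ := A.hθ₀,
    hN := A.hN, hT := A.hT, hST := A.hST, hOD := A.hOD }

/-! ## §3 ★★★★ K1 and FCL 23943 from the analytic rate input alone -/

/-- ★★★★ **K1 `NearFlatRatioLaw` ⇐ THE ANALYTIC RATE INPUT** (`s = 1/40`, `K = 43`, `M ≥ 2`) on every `L ≥ 2`. [cite: Luscher1983, §3] -/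
theorem nearFlatRatioLaw_of_analyticRateInput (M : ℝ) (hM : 2 ≤ M) (A : ∀ (L : ℕ) [NeZero L], 2 ≤ L → RecordAnalyticRateInput L (1 / 40) M) :
    Summit.QuantumFields.YangMills.Theses.FlatTubeReduction.NearFlatRatioLaw :=
  Summit.QuantumFields.YangMills.Theorems.FlatTubeReduction.nearFlatRatioLaw_of_innerRate fun L _ hL =>
    innerRateAt_of_ratePackage (L := L) 1 (fun β => powScale_pos (1 / 40) β) powScale_fortieth_eventually_le
      (softTubeAdmissible_recordChi' (1 / 40) 43 M (by norm_num) hM)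
      (softTubeBORatePackageOn_of_rateBricks
        (boRateBricks_record (by norm_num) (by linarith) ((A L hL).toRecordBORateInput (by norm_num) (by norm_num) (by linarith))))

/-- ★★★★ **FCL 23943 `FemtoGapFixedLattice` ⇐ the analytic rate input**, likewise (`L = 1` is crux ONE). [cite: Luscher1983, §3] -/
theorem femtoGapFixedLattice_of_analyticRateInput (M : ℝ) (hM : 2 ≤ M) (A : ∀ (L : ℕ) [NeZero L], 2 ≤ L → RecordAnalyticRateInput L (1 / 40) M) :
    FemtoGapFixedLattice := by
  intro L _
  by_cases hL : 2 ≤ L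
  · exact femtoGapFixedLatticeAt_of_valley_innerRate (L := L) (p := 1 / 40) (q := 17 / 20) (by norm_num) (by norm_num) (by norm_num)
      (valleyGainAt_ledger hL)
      (innerRateAt_of_ratePackage (L := L) 1 (fun β => powScale_pos (1 / 40) β) powScale_fortieth_eventually_le
        (softTubeAdmissible_recordChi' (1 / 40) 43 M (by norm_num) hM)
        (softTubeBORatePackageOn_of_rateBricks
          (boRateBricks_record (by norm_num) (by linarith) ((A L hL).toRecordBORateInput (by norm_num) (by norm_num) (by linarith)))))
  · have hL1 : L = 1 := by
      have h0 : L ≠ 0 := NeZero.ne L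
      omega
    subst hL1
    exact femtoGapOneSite_proof

end Summit.QuantumFields.YangMills.Theorems.FemtoTransferGap.RateTube

end
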